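import Summits.Ventures.DiscreteObjects.UnitDistance.FieldPlanes
import HarnessLib

/-!
# No `√3`-pair gadget inside the `P`-world `ℚ(√g) × √3·ℚ(√g)` (`g ≡ 2 mod 3`) — cell `pub-namedobj`, target (U), seat udg g22

Framing (verbatim for the cell): lottery ticket; floor = certified bounds/negative ranges.

`Sqrt3PairReduction` (udg g21) reduces `χ(ℚ(√3,√5)²) = 5` (hence `χ(ℚ₁₁²) = 5`) to ONE finite unit-distance graph over an
admissible field `K = ℚ(√3, √g)` in which some pair at distance `√3` is NON-monochromatic in every proper `4`-colouring
(Haugland's gadget, arXiv:2608.04542 §3).  All of Heule's machinery except the Moser rotation `θ₃` — the hexagonal vectors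
`ζ₆^j`, the rotation `θ₄ = (7 + i√15)/8`, the pentagon vector `u = (−1 + i√15)/4` — lives in the `P`-WORLD
`P_g = {(x, √3·y) : x, y ∈ ℚ(√g)}` (`g = 5`).  This file proves that NO gadget can be built there, for every `g ≡ 2 (mod 3)`
(the admissibility condition of the cell's THEORY-U21 §2: `g = 5, 23, 47, 53, …`):

* `PWorld.colour` is a proper `3`-colouring of the unit-distance graph on the `3`-integral `P`-world
  `pWorld g = {((a + b√g)/n, √3 (c + d√g)/n) : a b c d ∈ ℤ, n ∈ ℕ, 3 ∤ n}` (`coloringThree`, `colorable_three_pWorld`), and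
* EVERY pair of its points at distance `√3` is MONOCHROMATIC (`colour_eq_of_dist_eq_sqrt3`); hence for every `√3`-pair
  `p, q` there is a proper `4`-colouring `C` with `C p = C q` (`exists_coloring_four_sqrt3_pair_monochromatic`): no finite
  `P`-world configuration is a non-monochromatic-`√3`-pair gadget, and a 5-chromatic graph over `ℚ(√3,√g)` must mix worlds.

The proof is the residue map at the prime `3` written out in integers: two points at squared distance `m` with numerators
`A + B√g`, `√3 (C + D√g)` and denominator `N` (`3 ∤ N`) satisfy `A² + g B² + 3 C² + 3 g D² = m N²` and `A B + 3 C D = 0`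
(`int_identities`; `√g ∉ ℚ`), so mod `3`: `A B ≡ 0` and `A² + 2 B² ≡ m N²`; for `m = 1` this forces `B ≡ 0`, `A ≡ ±N`, for
`m = 3` it forces `A ≡ B ≡ 0` (`zmod3_step`).  The colour `a·n mod 3` of `((a + b√g)/n, …)` therefore changes by `±1` along
every edge and by `0` along every `√3`-pair.  (Unit vectors of `P_g` are automatically `3`-integral — `x² + 3y² = 1` is
anisotropic at the inert prime `3` of `ℚ(√g)` — so the `3`-integrality built into `pWorld` only fixes a translation class;
this remark is not needed and not formalised.)  Seat analysis THEORY-U21 §3 (udg g21) made formal and generalised from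
`g = 5` to `g ≡ 2 (mod 3)`; elementary; ours; nothing here is cited as a fact.
-/

noncomputable section

namespace Summit.Ventures.DiscreteObjects.UnitDistance

open SimpleGraph

namespace PWorld

/-- The `3`-integral `P`-world of `ℚ(√3, √g)`: points `((a + b√g)/n, √3·(c + d√g)/n)` with integers `a b c d` and a natural
denominator `n` not divisible by `3`. -/
def pWorld (g : ℕ) : Set (EuclideanSpace ℝ (Fin 2)) :=
  {q | ∃ (a b c d : ℤ) (n : ℕ), ¬ 3 ∣ n ∧
    q 0 = ((a : ℝ) + (b : ℝ) * Real.sqrt g) / n ∧ q 1 = Real.sqrt 3 * ((c : ℝ) + (d : ℝ) * Real.sqrt g) / n}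

/-- A representation `(a, b, c, d; n)` of a point of the `P`-world. -/
structure Rep (g : ℕ) (q : EuclideanSpace ℝ (Fin 2)) where
  /-- numerator of the first coordinate: rational part -/
  a : ℤ
  /-- numerator of the first coordinate: `√g` part -/
  b : ℤ
  /-- numerator of the second coordinate (after the factor `√3`): rational part -/
  c : ℤ
  /-- numerator of the second coordinate (after the factor `√3`): `√g` part -/
  d : ℤ
  /-- the common denominator -/
  n : ℕ
  /-- the denominator is prime to `3` -/
  hn : ¬ 3 ∣ n
  /-- first coordinate -/
  hx : q 0 = ((a : ℝ) + (b : ℝ) * Real.sqrt g) / n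
  /-- second coordinate -/
  hy : q 1 = Real.sqrt 3 * ((c : ℝ) + (d : ℝ) * Real.sqrt g) / n

/-- Every point of `pWorld g` has a representation (one is chosen once and for all). -/
def rep (g : ℕ) (q : pWorld g) : Rep g (q : EuclideanSpace ℝ (Fin 2)) :=
  ⟨q.2.choose, q.2.choose_spec.choose, q.2.choose_spec.choose_spec.choose,
    q.2.choose_spec.choose_spec.choose_spec.choose,
    q.2.choose_spec.choose_spec.choose_spec.choose_spec.choose,
    q.2.choose_spec.choose_spec.choose_spec.choose_spec.choose_spec.1,
    q.2.choose_spec.choose_spec.choose_spec.choose_spec.choose_spec.2.1,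
    q.2.choose_spec.choose_spec.choose_spec.choose_spec.choose_spec.2.2⟩

/-- The colour of a point: `a · n mod 3` for its chosen representation `((a + b√g)/n, …)` (as `n² ≡ 1 (mod 3)`, this is
`a / n mod 3`, i.e. the residue of the first coordinate in `F₉ = 𝓞_{ℚ(√g)}/3` read in `F₉ / F₃·√g ≅ F₃`). -/
def colour (g : ℕ) (q : pWorld g) : ZMod 3 := ((rep g q).a : ZMod 3) * ((rep g q).n : ZMod 3)

/-- `x + y√g = 0` with integers `x, y` and `g` not a perfect square forces `x = 0` and `y = 0`. -/
theorem int_eq_zero_of_add_mul_sqrt_eq_zero {g : ℕ} (hg : ¬ IsSquare g) {x y : ℤ}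
    (h : (x : ℝ) + (y : ℝ) * Real.sqrt g = 0) : x = 0 ∧ y = 0 := by
  have hirr : Irrational (Real.sqrt (g : ℝ)) := by
    have : ¬ IsSquare (g : ℚ) := fun hsq => hg (by exact_mod_cast hsq)
    have h2 := irrational_sqrt_ratCast_iff.2 ⟨this, by exact_mod_cast Nat.cast_nonneg g⟩
    simpa using h2
  by_cases hy : y = 0
  · subst hy
    refine ⟨?_, rfl⟩
    have : (x : ℝ) = 0 := by simpa using h
    exact_mod_cast this
  · exfalso
    have hyr : (y : ℝ) ≠ 0 := by exact_mod_cast hy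
    refine hirr ⟨-x / y, ?_⟩
    push_cast
    field_simp
    linarith

/-- `g ≡ 2 (mod 3)` is never a perfect square. -/
theorem not_isSquare_of_mod_three {g : ℕ} (hg : g % 3 = 2) : ¬ IsSquare g := by
  rintro ⟨r, hr⟩
  have h : (g : ZMod 3) = (r : ZMod 3) * r := by rw [hr]; push_cast; rfl
  have hg' : (g : ZMod 3) = 2 := by
    have := (ZMod.natCast_mod g 3).symm
    rw [hg] at this
    exact_mod_cast this
  rw [hg'] at h
  generalize (r : ZMod 3) = s at h
  revert s h
  decide

/-- THE INTEGER IDENTITIES of two `P`-world points at squared distance `m ∈ ℤ`: with `A = a n' − a' n`, …, `N = n n'`,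
`A² + g B² + 3 C² + 3 g D² = m N²` and `A B + 3 C D = 0` (the `√g`-part vanishes because `√g ∉ ℚ`). -/
theorem int_identities {g : ℕ} (hg : g % 3 = 2) {p q : EuclideanSpace ℝ (Fin 2)} (P : Rep g p) (Q : Rep g q) {m : ℤ}
    (h : dist p q ^ 2 = m) :
    (P.a * Q.n - Q.a * P.n) ^ 2 + (g : ℤ) * (P.b * Q.n - Q.b * P.n) ^ 2 + 3 * (P.c * Q.n - Q.c * P.n) ^ 2
        + 3 * (g : ℤ) * (P.d * Q.n - Q.d * P.n) ^ 2 = m * ((P.n : ℤ) * Q.n) ^ 2 ∧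
      (P.a * Q.n - Q.a * P.n) * (P.b * Q.n - Q.b * P.n) + 3 * ((P.c * Q.n - Q.c * P.n) * (P.d * Q.n - Q.d * P.n)) = 0 := by
  have hPn : (P.n : ℝ) ≠ 0 := by
    have : P.n ≠ 0 := by rintro h0; exact P.hn (h0 ▸ dvd_zero 3)
    exact_mod_cast this
  have hQn : (Q.n : ℝ) ≠ 0 := by
    have : Q.n ≠ 0 := by rintro h0; exact Q.hn (h0 ▸ dvd_zero 3)
    exact_mod_cast this
  have s3 : Real.sqrt 3 ^ 2 = 3 := Real.sq_sqrt (by norm_num)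
  have sg : Real.sqrt g ^ 2 = g := Real.sq_sqrt (Nat.cast_nonneg g)
  have hd : dist p q ^ 2 = (p 0 - q 0) ^ 2 + (p 1 - q 1) ^ 2 := by
    rw [EuclideanSpace.dist_sq_eq, Fin.sum_univ_two, Real.dist_eq, Real.dist_eq, sq_abs, sq_abs]
  set A : ℤ := P.a * Q.n - Q.a * P.n with hA
  set B : ℤ := P.b * Q.n - Q.b * P.n with hB
  set C : ℤ := P.c * Q.n - Q.c * P.n with hC
  set D : ℤ := P.d * Q.n - Q.d * P.n with hD
  have e0 : ((P.n : ℝ) * Q.n) * (p 0 - q 0) = (A : ℝ) + (B : ℝ) * Real.sqrt g := by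
    rw [P.hx, Q.hx, hA, hB]; push_cast; field_simp; ring
  have e1 : ((P.n : ℝ) * Q.n) * (p 1 - q 1) = Real.sqrt 3 * ((C : ℝ) + (D : ℝ) * Real.sqrt g) := by
    rw [P.hy, Q.hy, hC, hD]; push_cast; field_simp; ring
  have hm : ((P.n : ℝ) * Q.n) ^ 2 * ((p 0 - q 0) ^ 2 + (p 1 - q 1) ^ 2) = ((P.n : ℝ) * Q.n) ^ 2 * m := by rw [← hd, h]
  have h2 : ((A : ℝ) + (B : ℝ) * Real.sqrt g) ^ 2 + (Real.sqrt 3 * ((C : ℝ) + (D : ℝ) * Real.sqrt g)) ^ 2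
      = ((P.n : ℝ) * Q.n) ^ 2 * m := by
    rw [← e0, ← e1]; linear_combination hm
  have h3 : ((A ^ 2 + (g : ℤ) * B ^ 2 + 3 * C ^ 2 + 3 * (g : ℤ) * D ^ 2 - m * ((P.n : ℤ) * Q.n) ^ 2 : ℤ) : ℝ)
      + ((2 * (A * B + 3 * (C * D)) : ℤ) : ℝ) * Real.sqrt g = 0 := by
    push_cast
    linear_combination h2 - ((B : ℝ) ^ 2 + 3 * (D : ℝ) ^ 2) * sg
      - ((C : ℝ) ^ 2 + (D : ℝ) ^ 2 * Real.sqrt g ^ 2 + 2 * (C : ℝ) * D * Real.sqrt g) * s3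
  obtain ⟨hX, hY⟩ := int_eq_zero_of_add_mul_sqrt_eq_zero (not_isSquare_of_mod_three hg) h3
  refine ⟨by linarith, by linarith⟩

/-- The finite check behind the colouring: over `ZMod 3`, with `N ≠ 0` and `A B = 0`, the unit equation `A² + 2B² = N²`
forces `A N ≠ 0` (indeed `= ±1`), and the `√3` equation `A² + 2B² = 0` forces `A N = 0`. -/
theorem zmod3_step : ∀ A B N : ZMod 3, N ≠ 0 → A * B = 0 →
    (A ^ 2 + 2 * B ^ 2 = N ^ 2 → A * N ≠ 0) ∧ (A ^ 2 + 2 * B ^ 2 = 0 → A * N = 0) := by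
  decide

/-- Reduction of the integer identities mod `3`: for two points of `pWorld g` (`g ≡ 2 mod 3`) at squared distance `m`,
with `A, B, N` as in `int_identities`: `A B = 0` and `A² + 2 B² = m N²` in `ZMod 3`, `N ≠ 0`, and the colour difference is
`A · N`. -/
theorem zmod3_identities {g : ℕ} (hg : g % 3 = 2) (p q : pWorld g) {m : ℤ}
    (h : dist (p : EuclideanSpace ℝ (Fin 2)) q ^ 2 = m) :
    let P := rep g p; let Q := rep g q
    let A : ZMod 3 := ((P.a * Q.n - Q.a * P.n : ℤ) : ZMod 3)
    let B : ZMod 3 := ((P.b * Q.n - Q.b * P.n : ℤ) : ZMod 3)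
    let N : ZMod 3 := (((P.n : ℤ) * Q.n : ℤ) : ZMod 3)
    N ≠ 0 ∧ A * B = 0 ∧ A ^ 2 + 2 * B ^ 2 = (m : ZMod 3) * N ^ 2 ∧ colour g p - colour g q = A * N := by
  intro P Q A B N
  obtain ⟨h1, h2⟩ := int_identities hg P Q h
  have c1 := congrArg (Int.cast : ℤ → ZMod 3) h1
  have c2 := congrArg (Int.cast : ℤ → ZMod 3) h2
  push_cast at c1 c2
  have h3z : (3 : ZMod 3) = 0 := by decide
  have hgz : ((g : ℕ) : ZMod 3) = 2 := by
    have := (ZMod.natCast_mod g 3).symm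
    rw [hg] at this
    exact_mod_cast this
  rw [h3z, hgz] at c1
  rw [h3z] at c2
  have hPn : ((P.n : ℤ) : ZMod 3) ≠ 0 := by
    intro h0
    apply P.hn
    have : ((P.n : ℕ) : ZMod 3) = 0 := by exact_mod_cast h0
    exact (ZMod.natCast_eq_zero_iff _ _).1 this
  have hQn : ((Q.n : ℤ) : ZMod 3) ≠ 0 := by
    intro h0
    apply Q.hn
    have : ((Q.n : ℕ) : ZMod 3) = 0 := by exact_mod_cast h0
    exact (ZMod.natCast_eq_zero_iff _ _).1 this
  have hsqP : ((P.n : ℤ) : ZMod 3) ^ 2 = 1 := by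
    generalize ((P.n : ℤ) : ZMod 3) = s at hPn ⊢; revert s; decide
  have hsqQ : ((Q.n : ℤ) : ZMod 3) ^ 2 = 1 := by
    generalize ((Q.n : ℤ) : ZMod 3) = s at hQn ⊢; revert s; decide
  refine ⟨?_, ?_, ?_, ?_⟩
  · show (((P.n : ℤ) * Q.n : ℤ) : ZMod 3) ≠ 0
    push_cast
    exact mul_ne_zero hPn hQn
  · show ((P.a * Q.n - Q.a * P.n : ℤ) : ZMod 3) * ((P.b * Q.n - Q.b * P.n : ℤ) : ZMod 3) = 0
    push_cast
    linear_combination c2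
  · show ((P.a * Q.n - Q.a * P.n : ℤ) : ZMod 3) ^ 2 + 2 * ((P.b * Q.n - Q.b * P.n : ℤ) : ZMod 3) ^ 2
      = (m : ZMod 3) * (((P.n : ℤ) * Q.n : ℤ) : ZMod 3) ^ 2
    push_cast
    linear_combination c1
  · show ((P.a : ZMod 3)) * ((P.n : ℕ) : ZMod 3) - ((Q.a : ZMod 3)) * ((Q.n : ℕ) : ZMod 3)
      = ((P.a * Q.n - Q.a * P.n : ℤ) : ZMod 3) * (((P.n : ℤ) * Q.n : ℤ) : ZMod 3)
    push_cast
    push_cast at hsqP hsqQ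
    linear_combination (-(P.a : ZMod 3) * (P.n : ZMod 3)) * hsqQ + ((Q.a : ZMod 3) * (Q.n : ZMod 3)) * hsqP

/-- Adjacent points of the `P`-world (distance `1`) get DIFFERENT colours. -/
theorem colour_ne_of_dist_eq_one {g : ℕ} (hg : g % 3 = 2) (p q : pWorld g)
    (h : dist (p : EuclideanSpace ℝ (Fin 2)) q = 1) : colour g p ≠ colour g q := by
  have h' : dist (p : EuclideanSpace ℝ (Fin 2)) q ^ 2 = ((1 : ℤ) : ℝ) := by rw [h]; norm_num
  obtain ⟨hN, hAB, hsq, hcol⟩ := zmod3_identities hg p q h'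
  rw [Int.cast_one, one_mul] at hsq
  have := (zmod3_step _ _ _ hN hAB).1 hsq
  intro heq
  apply this
  rw [← hcol, heq, sub_self]

/-- Points of the `P`-world at distance `√3` get THE SAME colour. -/
theorem colour_eq_of_dist_eq_sqrt3 {g : ℕ} (hg : g % 3 = 2) (p q : pWorld g)
    (h : dist (p : EuclideanSpace ℝ (Fin 2)) q = Real.sqrt 3) : colour g p = colour g q := by
  have h' : dist (p : EuclideanSpace ℝ (Fin 2)) q ^ 2 = ((3 : ℤ) : ℝ) := by
    rw [h]; push_cast; exact Real.sq_sqrt (by norm_num)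
  obtain ⟨hN, hAB, hsq, hcol⟩ := zmod3_identities hg p q h'
  rw [show ((3 : ℤ) : ZMod 3) = 0 by decide, zero_mul] at hsq
  have := (zmod3_step _ _ _ hN hAB).2 hsq
  rwa [← hcol, sub_eq_zero] at this

/-- THE 3-COLOURING: `colour` is a proper colouring of the unit-distance graph on the `P`-world (`g ≡ 2 mod 3`). -/
def coloringThree {g : ℕ} (hg : g % 3 = 2) : (planeUnitDistanceGraph.induce (pWorld g)).Coloring (ZMod 3) :=
  Coloring.mk (colour g) fun {p q} hadj => colour_ne_of_dist_eq_one hg p q hadj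

/-- The `P`-world of `ℚ(√3, √g)` is `3`-colourable for every `g ≡ 2 (mod 3)`. -/
theorem colorable_three_pWorld {g : ℕ} (hg : g % 3 = 2) : (planeUnitDistanceGraph.induce (pWorld g)).Colorable 3 := by
  have h := (coloringThree hg).colorable
  simpa using h

/-- NO `√3`-PAIR GADGET IN THE `P`-WORLD: for every pair `p, q ∈ pWorld g` at distance `√3` there is a proper `4`-colouring
of the whole `P`-world unit-distance graph in which `p` and `q` have the same colour; in particular no finite `P`-world
configuration containing `p, q` is non-`4`-colourable after identifying `p` with `q` (Haugland's gadget condition). -/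
theorem exists_coloring_four_sqrt3_pair_monochromatic {g : ℕ} (hg : g % 3 = 2) (p q : pWorld g)
    (h : dist (p : EuclideanSpace ℝ (Fin 2)) q = Real.sqrt 3) :
    ∃ C : (planeUnitDistanceGraph.induce (pWorld g)).Coloring (Fin 4), C p = C q := by
  let f : ZMod 3 ↪ Fin 4 := ⟨fun x => (x : Fin 3).castSucc, fun x y hxy => by
    have := Fin.castSucc_injective _ hxy; exact_mod_cast this⟩
  refine ⟨(planeUnitDistanceGraph.induce (pWorld g)).recolorOfEmbedding f (coloringThree hg), ?_⟩
  show f (colour g p) = f (colour g q)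
  rw [colour_eq_of_dist_eq_sqrt3 hg p q h]

/-- For any finite set of vertices of the `P`-world containing a `√3`-pair `p, q`, the induced graph has a proper
`4`-colouring with `p, q` monochromatic (restriction of the global one) — the finite form of the no-go. -/
theorem finite_configuration_not_a_gadget {g : ℕ} (hg : g % 3 = 2) (S : Set (pWorld g)) (p q : pWorld g)
    (hp : p ∈ S) (hq : q ∈ S) (h : dist (p : EuclideanSpace ℝ (Fin 2)) q = Real.sqrt 3) :
    ∃ C : ((planeUnitDistanceGraph.induce (pWorld g)).induce S).Coloring (Fin 4), C ⟨p, hp⟩ = C ⟨q, hq⟩ := by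
  obtain ⟨C, hC⟩ := exists_coloring_four_sqrt3_pair_monochromatic hg p q h
  refine ⟨Coloring.mk (fun v => C v.1) fun {v w} hvw => C.valid hvw, ?_⟩
  show C p = C q
  exact hC

/-! ## The world is the right one: `ζ₆`, Heule's `θ₄` and `u` are `P`-world unit vectors (`g = 5`) -/

/-- Membership in `pWorld g` from an explicit representation. -/
theorem mk_mem_pWorld (g : ℕ) (a b c d : ℤ) (n : ℕ) (hn : ¬ 3 ∣ n) :
    !₂[((a : ℝ) + (b : ℝ) * Real.sqrt g) / n, Real.sqrt 3 * ((c : ℝ) + (d : ℝ) * Real.sqrt g) / n] ∈ pWorld g :=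
  ⟨a, b, c, d, n, hn, by simp, by simp⟩

/-- The origin, `ζ₆ = (1/2, √3/2)`, Heule's `θ₄ = (7/8, √15/8)` and `u = (−1/4, √15/4)` written as `P`-world points (`g = 5`). -/
def origin : EuclideanSpace ℝ (Fin 2) := !₂[((0 : ℤ) + ((0 : ℤ) : ℝ) * Real.sqrt (5 : ℕ)) / (1 : ℕ),
  Real.sqrt 3 * (((0 : ℤ) : ℝ) + ((0 : ℤ) : ℝ) * Real.sqrt (5 : ℕ)) / (1 : ℕ)]
/-- see `origin` -/
def zeta6 : EuclideanSpace ℝ (Fin 2) := !₂[(((1 : ℤ) : ℝ) + ((0 : ℤ) : ℝ) * Real.sqrt (5 : ℕ)) / (2 : ℕ),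
  Real.sqrt 3 * (((1 : ℤ) : ℝ) + ((0 : ℤ) : ℝ) * Real.sqrt (5 : ℕ)) / (2 : ℕ)]
/-- see `origin` -/
def theta4 : EuclideanSpace ℝ (Fin 2) := !₂[(((7 : ℤ) : ℝ) + ((0 : ℤ) : ℝ) * Real.sqrt (5 : ℕ)) / (8 : ℕ),
  Real.sqrt 3 * (((0 : ℤ) : ℝ) + ((1 : ℤ) : ℝ) * Real.sqrt (5 : ℕ)) / (8 : ℕ)]
/-- see `origin` -/
def uVec : EuclideanSpace ℝ (Fin 2) := !₂[(((-1 : ℤ) : ℝ) + ((0 : ℤ) : ℝ) * Real.sqrt (5 : ℕ)) / (4 : ℕ),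
  Real.sqrt 3 * (((0 : ℤ) : ℝ) + ((1 : ℤ) : ℝ) * Real.sqrt (5 : ℕ)) / (4 : ℕ)]

/-- All four sample points lie in `pWorld 5`. -/
theorem samples_mem : origin ∈ pWorld 5 ∧ zeta6 ∈ pWorld 5 ∧ theta4 ∈ pWorld 5 ∧ uVec ∈ pWorld 5 :=
  ⟨mk_mem_pWorld 5 0 0 0 0 1 (by decide), mk_mem_pWorld 5 1 0 1 0 2 (by decide),
    mk_mem_pWorld 5 7 0 0 1 8 (by decide), mk_mem_pWorld 5 (-1) 0 0 1 4 (by decide)⟩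

/-- `ζ₆`, `θ₄`, `u` are unit vectors: the `P`-world unit-distance graph contains Heule's non-Moser rotations. -/
theorem samples_unit : dist origin zeta6 = 1 ∧ dist origin theta4 = 1 ∧ dist origin uVec = 1 := by
  have s3 : Real.sqrt 3 ^ 2 = 3 := Real.sq_sqrt (by norm_num)
  have s5 : Real.sqrt 5 ^ 2 = 5 := Real.sq_sqrt (by norm_num)
  -- (the pattern of `Sqrt3Pair.dist_mk_eq_one`, udg g21, inlined: that module is not yet built on the farm)
  have key : ∀ {a b c d : ℝ}, (a - c) ^ 2 + (b - d) ^ 2 = 1 → dist !₂[a, b] !₂[c, d] = 1 := by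
    intro a b c d h
    have hd : dist !₂[a, b] !₂[c, d] ^ 2 = 1 := by
      rw [EuclideanSpace.dist_sq_eq, Fin.sum_univ_two, Real.dist_eq, Real.dist_eq, sq_abs, sq_abs]
      simpa using h
    exact (pow_eq_one_iff_of_nonneg dist_nonneg two_ne_zero).1 hd
  refine ⟨key ?_, key ?_, key ?_⟩
  · push_cast; linear_combination (1/4 : ℝ) * s3
  · push_cast; linear_combination (1/64 : ℝ) * Real.sqrt 5 ^ 2 * s3 + (3/64 : ℝ) * s5
  · push_cast; linear_combination (1/16 : ℝ) * Real.sqrt 5 ^ 2 * s3 + (3/16 : ℝ) * s5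

/-- The `P`-world sits inside the field plane `K²` whenever `√3, √g ∈ K` (so the no-go is a statement about a sub-world
of the admissible planes `ℚ(√3, √g)²` of `Sqrt3PairReduction`). -/
theorem pWorld_subset_fieldPoints (g : ℕ) (K : IntermediateField ℚ ℝ) (h3 : Real.sqrt 3 ∈ K) (hg : Real.sqrt g ∈ K) :
    pWorld g ⊆ fieldPoints K := by
  rintro q ⟨a, b, c, d, n, -, hx, hy⟩ i
  have hq : ∀ r : ℚ, (r : ℝ) ∈ K := fun r => SubfieldClass.ratCast_mem K r
  have hz : ∀ z : ℤ, (z : ℝ) ∈ K := fun z => by have := hq z; push_cast at this; exact this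
  have hnK : (n : ℝ) ∈ K := by have := hq n; push_cast at this; exact this
  fin_cases i
  · show q 0 ∈ K
    rw [hx]; exact div_mem (add_mem (hz a) (mul_mem (hz b) hg)) hnK
  · show q 1 ∈ K
    rw [hy]; exact div_mem (mul_mem h3 (add_mem (hz c) (mul_mem (hz d) hg))) hnK

end PWorld

end Summit.Ventures.DiscreteObjects.UnitDistance
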